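import Mathlib.Analysis.SpecialFunctions.Pow.Real
import Literature.Computability.AlgebraicComplexity.RectangularExponent
import Literature.Computability.AlgebraicComplexity.SchonhageRectangular
import Literature.Computability.AlgebraicComplexity.AsymptoticRankBorderRank
import Literature.Computability.AlgebraicComplexity.BigCoppersmithWinograd
import Literature.Barriers.MatrixMultiplication.UniversalMethodBarrierAsymptoticRank
import HarnessLib

/-!
# From a degeneration of `⟨M⟩ ⊗ CW_q^{⊗N}` into independent cubes to a bound on `ω` — proved

Topic `Literature/Computability/AlgebraicComplexity`.  The last classical step of every laser-method
bound on `ω` since Coppersmith–Winograd, in the tree's terms, as the ASSEMBLY LEMMA for the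
decomposition of the named fact `vxxz2024_omega_le` (`RectangularExponent.lean`;
Vassilevska Williams–Xu–Xu–Zhou 2024): their algorithm (§4–§7) "accepts `CW_q^{⊗N}` as its input for
a large enough `N`, and degenerates it into a collection of independent matrix multiplication tensors
of the same size `⟨m, m^κ, m⟩`. By the asymptotic sum inequality (Thm. 3.2), this will give an upper
bound on `ω(1, κ, 1)`" (§4; Thm. 5.3: "`2^{o(n)}` independent copies of `(CW_q^{⊗2^{l-1}})^{⊗n}` can be
degenerated into …"; §8, first paragraph).  Here, for `κ = 1`:

* `asymptoticRank_multiple_kroneckerPow_bigCwTensor_le` — **`R̃(⟨M⟩ ⊗ CW_q^{⊗N}) ≤ M (q+2)^N`**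
  (`R_{3N}(⟨M⟩ ⊗ CW_q^{⊗N}) ≤ R(⟨M⟩) · R_3(CW_q)^N`, Bläser 2013, Thm. 6.3(3), with Coppersmith–
  Winograd's `R_3(CW_q) ≤ q + 2`, `BigCoppersmithWinograd.approxRank_three_bigCwTensor_le`, and
  `R̃ ≤ R_h`, `AsymptoticRankBorderRank.asymptoticRank_le_approxRank`; VXXZ §3.6 "`R̃(CW_q) ≤ q + 2`").
* `mul_rpow_omega_le_of_polyDegeneratesTo` — if `⟨M⟩ ⊗ CW_q^{⊗N} ⊵ ⟨t⟩ ⊗ ⟨a, a, a⟩` (degeneration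
  over `K[λ]`, VXXZ §3.3 = `Literature.Barriers.MatrixMultiplication.PolyDegeneratesTo`) with
  `t ≥ 1`, `a ≥ 2`, then **`t · a^ω ≤ M (q+2)^N`**: Schönhage's asymptotic sum inequality in
  asymptotic-rank form (`SchonhageRectangular.mul_rpow_omegaRect_le_asymptoticRank`, VXXZ Thm. 3.2
  with `a = b = c`), monotonicity of `R̃` under degeneration
  (`asymptoticRank_le_of_polyDegeneratesTo`, VXXZ §3.3/§2.1) and the previous bound.
* `omega_le_of_polyDegeneratesTo` — the same as `ω ≤ (log M + N log(q+2) − log t) / log a`.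
* `omega_le_of_forall_polyDegeneratesTo` — **the `δ`-form**: if for every `δ > 0` there are such
  degenerations with `M (q+2)^N ≤ t · a^{w+δ}`, then `ω ≤ w`.  This is the shape in which the output
  of VXXZ's §4–§8 (and of every later laser-method paper) enters; the method itself (Thms. 5.3, 6.1,
  6.3, 7.2 and the numerical optimisation of §8) is NOT formalised here.

Everything in this file is PROVED; no definitions, no named facts.

## References

* V. Vassilevska Williams, Y. Xu, Z. Xu, R. Zhou, *New bounds for matrix multiplication: from alpha
  to omega*, SODA 2024, arXiv:2307.07970: §2.1, §3.2–§3.6 (Thms. 3.1, 3.2; `R̃(CW_q) ≤ q + 2`), §4.1,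
  Thm. 5.3, §8. [VassilevskaWilliamsXuXuZhou2024]
* M. Bläser, *Fast Matrix Multiplication*, Theory of Computing Graduate Surveys 5 (2013), Thm. 6.3,
  Lemma 6.4, Thm. 7.5. [Blaser2013]
* P. Bürgisser, M. Clausen, M. A. Shokrollahi, *Algebraic Complexity Theory* (1997), (15.11),
  Lemma (15.27), §15.8. [BurgisserClausenShokrollahi1997]
-/

noncomputable section

open scoped BigOperators
open Literature.Barriers.MatrixMultiplication (bigCwTensor PolyDegeneratesTo
  asymptoticRank_le_of_polyDegeneratesTo)

namespace Literature.Computability.AlgebraicComplexity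

/-! ## `R̃(⟨M⟩ ⊗ CW_q^{⊗N}) ≤ M (q+2)^N` -/

section Upper

variable (K : Type) [Field K]

/-- `R(⟨M⟩) ≤ M` (the diagonal decomposition). [folklore] -/
private theorem tensorRank_unitTensor_le' (M : ℕ) : tensorRank (unitTensor K M) ≤ M := by
  have h := tensorRank_multiple_le M (unitTensor K 1)
  have h1 : tensorRank (unitTensor K 1) ≤ 1 := by
    refine tensorRank_le_of_eq_sum (fun _ _ => (1 : K)) (fun _ _ => 1) (fun _ _ => 1) ?_
    funext a b c
    rw [unitTensor_one, Finset.sum_apply, Finset.sum_apply, Finset.sum_apply]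
    simp [triad_apply]
  -- `⟨M⟩` is a relabelling of `⟨M⟩ ⊗ ⟨1⟩`
  have hre : unitTensor K M = fun a b c =>
      kroneckerTensor (unitTensor K M) (unitTensor K 1) (a, 0) (b, 0) (c, 0) := by
    funext a b c
    simp [kroneckerTensor_apply]
  calc tensorRank (unitTensor K M)
      = tensorRank (fun a b c => kroneckerTensor (unitTensor K M) (unitTensor K 1) (a, 0) (b, 0) (c, 0)) := by
        rw [← hre]
    _ ≤ tensorRank (kroneckerTensor (unitTensor K M) (unitTensor K 1)) := tensorRank_precomp_le _ _ _ _
    _ ≤ M * tensorRank (unitTensor K 1) := h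
    _ ≤ M * 1 := Nat.mul_le_mul_left _ h1
    _ = M := mul_one M

/-- **`R_{3N}(⟨M⟩ ⊗ CW_q^{⊗N}) ≤ M (q+2)^N`**: the product rule for approximate decompositions
(Bläser 2013, Thm. 6.3(3)) with `R_0(⟨M⟩) = R(⟨M⟩) ≤ M` and `R_{3N}(CW_q^{⊗N}) ≤ R_3(CW_q)^N ≤ (q+2)^N`
(Coppersmith–Winograd). [cite: VassilevskaWilliamsXuXuZhou2024, §3.6] -/
theorem approxRank_multiple_kroneckerPow_bigCwTensor_le (q M N : ℕ) :
    approxRank (0 + N * 3) (kroneckerTensor (unitTensor K M) (kroneckerPow (bigCwTensor K q) N)) ≤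
      M * (q + 2) ^ N := by
  classical
  refine (approxRank_kroneckerTensor_le 0 (N * 3) _ _).trans (Nat.mul_le_mul ?_ ?_)
  · rw [approxRank_zero]
    exact tensorRank_unitTensor_le' K M
  · exact (approxRank_kroneckerPow_le 3 _ N).trans
      (Nat.pow_le_pow_left (approxRank_three_bigCwTensor_le K q) N)

/-- **`R̃(⟨M⟩ ⊗ CW_q^{⊗N}) ≤ M (q+2)^N`** ("`R̃(CW_q) ≤ q + 2`", VXXZ §3.6, with `R̃ ≤ R_h` and the
product rule). [cite: VassilevskaWilliamsXuXuZhou2024, §3.6] -/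
theorem asymptoticRank_multiple_kroneckerPow_bigCwTensor_le (q M N : ℕ) :
    asymptoticRank (kroneckerTensor (unitTensor K M) (kroneckerPow (bigCwTensor K q) N)) ≤
      (M : ℝ) * ((q : ℝ) + 2) ^ N := by
  classical
  have h := (asymptoticRank_le_approxRank (0 + N * 3)
    (kroneckerTensor (unitTensor K M) (kroneckerPow (bigCwTensor K q) N))).trans
    (Nat.cast_le.2 (approxRank_multiple_kroneckerPow_bigCwTensor_le K q M N))
  push_cast at h
  exact h

end Upper

/-! ## The assembly: degeneration into independent cubes bounds `ω` -/

section Assembly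

variable (K : Type) [Field K]

/-- **If `⟨M⟩ ⊗ CW_q^{⊗N} ⊵ ⟨t⟩ ⊗ ⟨a,a,a⟩` with `t ≥ 1`, `a ≥ 2`, then `t · a^ω ≤ M (q+2)^N`**:
`t a^ω ≤ R̃(⟨t⟩ ⊗ ⟨a,a,a⟩)` (asymptotic sum inequality, VXXZ Thm. 3.2 with `a = b = c`)
`≤ R̃(⟨M⟩ ⊗ CW_q^{⊗N})` (degenerations do not increase `R̃`, §3.3) `≤ M (q+2)^N` (§3.6).
[cite: VassilevskaWilliamsXuXuZhou2024, Thm. 3.2 and §3.6] -/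
theorem mul_rpow_omega_le_of_polyDegeneratesTo {q M N t a : ℕ} (ht : 1 ≤ t) (ha : 2 ≤ a)
    (hdeg : PolyDegeneratesTo (kroneckerTensor (unitTensor K M) (kroneckerPow (bigCwTensor K q) N))
      (kroneckerTensor (unitTensor K t) (matMulTensor K a a a))) :
    (t : ℝ) * (a : ℝ) ^ omega K ≤ (M : ℝ) * ((q : ℝ) + 2) ^ N := by
  classical
  have h1 := mul_rpow_omegaRect_le_asymptoticRank K (k := 1) zero_le_one ht ha (B := a)
    (by rw [Real.rpow_one])
  rw [omegaRect_one_one_one] at h1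
  exact h1.trans ((asymptoticRank_le_of_polyDegeneratesTo hdeg).trans
    (asymptoticRank_multiple_kroneckerPow_bigCwTensor_le K q M N))

/-- The same bound solved for `ω`: **`ω ≤ (log M + N log(q+2) − log t) / log a`**.
[cite: VassilevskaWilliamsXuXuZhou2024, §8] -/
theorem omega_le_of_polyDegeneratesTo {q M N t a : ℕ} (ht : 1 ≤ t) (ha : 2 ≤ a) (hM : 1 ≤ M)
    (hdeg : PolyDegeneratesTo (kroneckerTensor (unitTensor K M) (kroneckerPow (bigCwTensor K q) N))
      (kroneckerTensor (unitTensor K t) (matMulTensor K a a a))) :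
    omega K ≤ (Real.log M + N * Real.log ((q : ℝ) + 2) - Real.log t) / Real.log a := by
  have h := mul_rpow_omega_le_of_polyDegeneratesTo K ht ha hdeg
  have ht0 : (0 : ℝ) < t := by exact_mod_cast (by omega : 0 < t)
  have ha1 : (1 : ℝ) < a := by exact_mod_cast (by omega : 1 < a)
  have ha0 : (0 : ℝ) < a := by linarith
  have hM0 : (0 : ℝ) < M := by exact_mod_cast (by omega : 0 < M)
  have hq0 : (0 : ℝ) < (q : ℝ) + 2 := by positivity
  have hloga : 0 < Real.log a := Real.log_pos ha1
  -- take logarithms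
  have hlog := Real.log_le_log (by positivity) h
  rw [Real.log_mul ht0.ne' (by positivity), Real.log_rpow ha0, Real.log_mul hM0.ne' (by positivity),
    Real.log_pow] at hlog
  rw [le_div_iff₀ hloga]
  linarith

/-- **The `δ`-form of the assembly**: if for every `δ > 0` some `⟨M⟩ ⊗ CW_q^{⊗N}` degenerates into
`⟨t⟩ ⊗ ⟨a,a,a⟩` (`t ≥ 1`, `a ≥ 2`) with `M (q+2)^N ≤ t · a^{w+δ}`, then `ω ≤ w` — the form in which
the output of a laser-method analysis of `CW_q` (VXXZ §4–§8: degenerate `2^{o(n)}` copies of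
`CW_q^{⊗N}` into independent `⟨m, m, m⟩` and plug the counts into the asymptotic sum inequality)
yields its bound on `ω`. [cite: VassilevskaWilliamsXuXuZhou2024, §8] -/
theorem omega_le_of_forall_polyDegeneratesTo {q : ℕ} {w : ℝ}
    (h : ∀ δ : ℝ, 0 < δ → ∃ t a M N : ℕ, 1 ≤ t ∧ 2 ≤ a ∧
      PolyDegeneratesTo (kroneckerTensor (unitTensor K M) (kroneckerPow (bigCwTensor K q) N))
        (kroneckerTensor (unitTensor K t) (matMulTensor K a a a)) ∧
      (M : ℝ) * ((q : ℝ) + 2) ^ N ≤ (t : ℝ) * (a : ℝ) ^ (w + δ)) :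
    omega K ≤ w := by
  refine le_of_forall_pos_le_add fun δ hδ => ?_
  obtain ⟨t, a, M, N, ht, ha, hdeg, hcount⟩ := h δ hδ
  have h1 := (mul_rpow_omega_le_of_polyDegeneratesTo K ht ha hdeg).trans hcount
  have ht0 : (0 : ℝ) < t := by exact_mod_cast (by omega : 0 < t)
  have ha1 : (1 : ℝ) < a := by exact_mod_cast (by omega : 1 < a)
  have h2 : (a : ℝ) ^ omega K ≤ (a : ℝ) ^ (w + δ) := le_of_mul_le_mul_left h1 ht0
  exact (Real.rpow_le_rpow_left_iff ha1).1 h2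

end Assembly

end Literature.Computability.AlgebraicComplexity

end
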